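import Mathlib
import Summits.MatrixMultiplication.MatrixMultiplication.Theorems.FidelityWitnessesFidelityGapThreeSeventeenDefs
import Summits.MatrixMultiplication.MatrixMultiplication.Theorems.FidelityWitnessesFidelityGapThreeSeventeenStubBorelNormalFormVectorFields

/-!
# Borel normal form, part 6: the line's Borel operators as linear vector fields

Support file for `stub_borelNormalForm` (line `symbolic-square-border-apolarity` of
`FidelityWitnesses.FidelityGapThreeSeventeen`).  The eighteen infinitesimal Borel operators `opU p q`,
`opV p q`, `opW p q` of the line's vocabulary are instances `opL X p q` (`X = 0, 1, 2`) of the linear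
vector fields of `…StubBorelNormalFormVectorFields`; this file records the identification
(`opU_eq`, `opV_eq`, `opW_eq`), the Leibniz rule, WEIGHT ZERO (every `opL` preserves every piece `S m`),
the degree of the pieces, NILPOTENCY of the non-diagonal operators on each piece (`(opL X p q)^k S m = 0`
for `k > |m|`, `p ≠ q`), the apolarity pairing as a linear functional `tPairL`, and the ROW/COLUMN
operations `rowOp`, `colOp` on each slot with `opU = R⁰ - R²`, `opV = -C⁰ + R¹`, `opW = -C¹ + C²`.
PROVED; depends on the line's `…Defs`.
-/

noncomputable section

namespace Summit.MatrixMultiplication.MatrixMultiplication.Theorems.SymbolicSquare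

-- single-conjunct summit: the `Summit.<S>.<P>` prefix repeats `MatrixMultiplication` by design (D-0017)
set_option linter.dupNamespace false

open scoped BigOperators Polynomial
open Polynomial

/-! ## The line's infinitesimal Borel operators as linear vector fields -/

section Ops

open BorelLimit

/-- The apolarity pairing `f ↦ ⟨f, t⟩` as a linear functional. -/
def tPairL (t : P3 → P3 → P3 → ℂ) : Poly →ₗ[ℂ] ℂ where
  toFun f := tPair t f
  map_add' f g := by
    simp only [tPair, MvPolynomial.coeff_add, add_mul, Finset.sum_add_distrib]
  map_smul' c f := by
    simp only [tPair, MvPolynomial.coeff_smul, smul_eq_mul, mul_assoc, ← Finset.mul_sum, RingHom.id_apply]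

/-- Unfolding lemma for `tPairL`. -/
@[simp] theorem tPairL_apply (t : P3 → P3 → P3 → ℂ) (f : Poly) : tPairL t f = tPair t f := rfl

/-- The exponent of the multilinear monomial `z_a x_b y_c`. -/
def ms (a b c : P3) : Var →₀ ℕ :=
  Finsupp.single ((2 : Fin 3), a) 1 + Finsupp.single ((0 : Fin 3), b) 1 + Finsupp.single ((1 : Fin 3), c) 1

/-- `tPair` as a sum over the multilinear monomials. -/
theorem tPair_eq_sum (t : P3 → P3 → P3 → ℂ) (f : Poly) :
    tPair t f = ∑ a : P3, ∑ b : P3, ∑ c : P3, MvPolynomial.coeff (ms a b c) f * t a b c := rfl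

/-! ### The three families as one: `opL X p q`, `X = 0, 1, 2` for `U, V, W` -/

/-- Coefficients of the two halves of each operator (`+x −z`, `−x +y`, `−y +z`). -/
def opc (X : Fin 3) : Fin 3 ⊕ Fin 3 → ℂ :=
  ![Sum.elim (fun _ => 1) (fun _ => -1), Sum.elim (fun _ => -1) (fun _ => 1), Sum.elim (fun _ => -1) (fun _ => 1)] X

/-- Target variables `b_i` of the moves of `opL X p q`. -/
def opb (X p q : Fin 3) : Fin 3 ⊕ Fin 3 → Var :=
  ![Sum.elim (fun j => ((0 : Fin 3), (q, j))) (fun k => ((2 : Fin 3), (p, k))),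
    Sum.elim (fun i => ((0 : Fin 3), (i, p))) (fun k => ((1 : Fin 3), (q, k))),
    Sum.elim (fun j => ((1 : Fin 3), (j, p))) (fun i => ((2 : Fin 3), (i, q)))] X

/-- Source variables `a_i` of the moves of `opL X p q`. -/
def opa (X p q : Fin 3) : Fin 3 ⊕ Fin 3 → Var :=
  ![Sum.elim (fun j => ((0 : Fin 3), (p, j))) (fun k => ((2 : Fin 3), (q, k))),
    Sum.elim (fun i => ((0 : Fin 3), (i, q))) (fun k => ((1 : Fin 3), (p, k))),
    Sum.elim (fun j => ((1 : Fin 3), (j, q))) (fun i => ((2 : Fin 3), (i, p)))] X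

/-- The operator `E_{pq}` of the `X`-th factor (`X = 0, 1, 2`: `U, V, W`) as a linear vector field. -/
def opL (X p q : Fin 3) : Poly →ₗ[ℂ] Poly := lvf (opc X) (opb X p q) (opa X p q)

/-- `opU` is the linear vector field `opL 0`. -/
theorem opU_eq (p q : Fin 3) : opU p q = opL 0 p q := by
  apply LinearMap.ext
  intro f
  simp [opU, opL, lvf_apply, opc, opb, opa, xd_apply, xA, zC, pd, Fintype.sum_sum_type, sub_eq_add_neg,
    Finset.sum_neg_distrib]

/-- `opV` is the linear vector field `opL 1`. -/
theorem opV_eq (p q : Fin 3) : opV p q = opL 1 p q := by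
  apply LinearMap.ext
  intro f
  simp [opV, opL, lvf_apply, opc, opb, opa, xd_apply, xA, yB, pd, Fintype.sum_sum_type, Finset.sum_neg_distrib]

/-- `opW` is the linear vector field `opL 2`. -/
theorem opW_eq (p q : Fin 3) : opW p q = opL 2 p q := by
  apply LinearMap.ext
  intro f
  simp [opW, opL, lvf_apply, opc, opb, opa, xd_apply, yB, zC, pd, Fintype.sum_sum_type, Finset.sum_neg_distrib]

/-- The operators are derivations. -/
theorem opL_leibniz (X p q : Fin 3) (f g : Poly) : opL X p q (f * g) = opL X p q f * g + f * opL X p q g :=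
  lvf_leibniz _ _ _ f g

/-- Every move of every operator stays in its slot. -/
theorem opa_fst_eq (X p q : Fin 3) (i : Fin 3 ⊕ Fin 3) : (opa X p q i).1 = (opb X p q i).1 := by
  fin_cases X <;> rcases i with j | k <;> rfl

/-- **Weight zero**: the operators preserve every multihomogeneous piece `S m`. -/
theorem opL_mem_S (X p q : Fin 3) (m : MDeg) {f : Poly} (hf : f ∈ S m) : opL X p q f ∈ S m :=
  lvf_mem_weightedHomogeneousSubmodule _ _ _ wt (fun i => by rw [wt, wt, opa_fst_eq]) m hf

/-- The total degree of an exponent of multidegree `m` is `|m|`. -/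
theorem degree_eq_of_weight (d : Var →₀ ℕ) :
    Finsupp.degree d = Finsupp.weight wt d 0 + Finsupp.weight wt d 1 + Finsupp.weight wt d 2 := by
  have h : ∀ s : Fin 3, Finsupp.weight wt d s = ∑ v ∈ d.support, d v * (if v.1 = s then 1 else 0) := by
    intro s
    rw [Finsupp.weight_apply, Finsupp.sum, Finset.sum_apply]
    refine Finset.sum_congr rfl fun v _ => ?_
    simp [wt, Pi.single_apply, eq_comm]
  rw [h, h, h, ← Finset.sum_add_distrib, ← Finset.sum_add_distrib, Finsupp.degree]
  simp only [AddMonoidHom.coe_mk, ZeroHom.coe_mk]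
  refine Finset.sum_congr rfl fun v _ => ?_
  have : (v.1 : Fin 3) = 0 ∨ v.1 = 1 ∨ v.1 = 2 := by
    rcases v with ⟨s, x⟩
    fin_cases s <;> simp
  rcases this with h0 | h1 | h2
  · simp [h0]
  · simp [h1]
  · simp [h2]

/-- `S m` consists of polynomials all of whose monomials have degree `|m| = m 0 + m 1 + m 2`. -/
theorem S_le_restrictSupport_degree (m : MDeg) :
    S m ≤ MvPolynomial.restrictSupport ℂ {d | Finsupp.degree d = m 0 + m 1 + m 2} := by
  intro f hf
  rw [S, MvPolynomial.weightedHomogeneousSubmodule_eq_finsupp_supported] at hf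
  rw [MvPolynomial.mem_restrictSupport_iff]
  intro d hd
  have hw : Finsupp.weight wt d = m := hf hd
  simp only [Set.mem_setOf_eq, degree_eq_of_weight, hw]

/-- The rising potential of a positive root operator (`p ≠ q`): `1` on its target variables. -/
def potOf (X p q : Fin 3) (v : Var) : ℕ :=
  ![if (v.1 = 0 ∧ v.2.1 = q) ∨ (v.1 = 2 ∧ v.2.1 = p) then 1 else 0,
    if (v.1 = 0 ∧ v.2.2 = p) ∨ (v.1 = 1 ∧ v.2.1 = q) then 1 else 0,
    if (v.1 = 1 ∧ v.2.2 = p) ∨ (v.1 = 2 ∧ v.2.2 = q) then 1 else 0] X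

/-- The potential is at most `1`. -/
theorem potOf_le_one (X p q : Fin 3) (v : Var) : potOf X p q v ≤ 1 := by
  fin_cases X <;> simp only [potOf] <;> split_ifs <;> simp

/-- The potential rises by one along every move of a non-diagonal operator. -/
theorem potOf_move (X p q : Fin 3) (hpq : p ≠ q) (i : Fin 3 ⊕ Fin 3) :
    potOf X p q (opb X p q i) = potOf X p q (opa X p q i) + 1 := by
  fin_cases X <;> rcases i with j | k <;> simp [potOf, opa, opb, hpq, hpq.symm]

/-- **Nilpotency**: a non-diagonal operator satisfies `(opL X p q)^k (S m) = 0` for `k > |m|`. -/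
theorem opL_pow_eq_zero (X p q : Fin 3) (hpq : p ≠ q) (m : MDeg) {f : Poly} (hf : f ∈ S m) {k : ℕ}
    (hk : m 0 + m 1 + m 2 + 1 ≤ k) : (opL X p q ^ k) f = 0 :=
  lvf_pow_eq_zero_of_degree _ _ _ (potOf X p q) 1 (potOf_le_one X p q) (potOf_move X p q hpq)
    (m 0 + m 1 + m 2) (S_le_restrictSupport_degree m hf) (by simpa using hk)

end Ops

/-! ## Row and column operations; the operators as `±row ± column` -/

section RowCol

open BorelLimit

/-- Leibniz rule is preserved by scalar multiples. -/
theorem leibniz_smul' {L : Poly →ₗ[ℂ] Poly} (h : ∀ f g : Poly, L (f * g) = L f * g + f * L g) (c : ℂ)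
    (f g : Poly) : (c • L) (f * g) = (c • L) f * g + f * (c • L) g := by
  simp only [LinearMap.smul_apply, h f g, smul_add, smul_mul_assoc, mul_smul_comm]

/-- Leibniz rule is preserved by differences. -/
theorem leibniz_sub' {L₁ L₂ : Poly →ₗ[ℂ] Poly} (h₁ : ∀ f g : Poly, L₁ (f * g) = L₁ f * g + f * L₁ g)
    (h₂ : ∀ f g : Poly, L₂ (f * g) = L₂ f * g + f * L₂ g) (f g : Poly) :
    (L₁ - L₂) (f * g) = (L₁ - L₂) f * g + f * (L₁ - L₂) g := by
  simp only [LinearMap.sub_apply, h₁ f g, h₂ f g]; ring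

/-- The zero map satisfies the Leibniz rule. -/
theorem leibniz_zero' (f g : Poly) : (0 : Poly →ₗ[ℂ] Poly) (f * g) = (0 : Poly →ₗ[ℂ] Poly) f * g + f * (0 : Poly →ₗ[ℂ] Poly) g := by
  simp

/-- The ROW operation `∑_j X_{(s,(q,j))} ∂_{(s,(p,j))}` on slot `s` (first index `p ↦ q`). -/
def rowOp (s p q : Fin 3) : Poly →ₗ[ℂ] Poly :=
  lvf (fun _ : Fin 3 => (1 : ℂ)) (fun j => (s, (q, j))) (fun j => (s, (p, j)))

/-- The COLUMN operation `∑_i X_{(s,(i,q))} ∂_{(s,(i,p))}` on slot `s` (second index `p ↦ q`). -/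
def colOp (s p q : Fin 3) : Poly →ₗ[ℂ] Poly :=
  lvf (fun _ : Fin 3 => (1 : ℂ)) (fun i => (s, (i, q))) (fun i => (s, (i, p)))

/-- Row operations are derivations. -/
theorem rowOp_leibniz (s p q : Fin 3) (f g : Poly) :
    rowOp s p q (f * g) = rowOp s p q f * g + f * rowOp s p q g := lvf_leibniz _ _ _ f g

/-- Column operations are derivations. -/
theorem colOp_leibniz (s p q : Fin 3) (f g : Poly) :
    colOp s p q (f * g) = colOp s p q f * g + f * colOp s p q g := lvf_leibniz _ _ _ f g

/-- A row operation on a variable. -/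
theorem rowOp_X (s p q : Fin 3) (s' i j : Fin 3) :
    rowOp s p q (MvPolynomial.X (s', (i, j))) = if s' = s ∧ i = p then MvPolynomial.X (s, (q, j)) else 0 := by
  rw [rowOp, lvf_X]
  simp only [Prod.mk.injEq, one_smul]
  by_cases h : s' = s ∧ i = p
  · obtain ⟨rfl, rfl⟩ := h
    simp [Finset.sum_ite_eq]
  · rw [if_neg h, Finset.sum_eq_zero]
    intro j' _
    rw [if_neg]
    rintro ⟨h1, h2, -⟩
    exact h ⟨h1, h2⟩

/-- A column operation on a variable. -/
theorem colOp_X (s p q : Fin 3) (s' i j : Fin 3) :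
    colOp s p q (MvPolynomial.X (s', (i, j))) = if s' = s ∧ j = p then MvPolynomial.X (s, (i, q)) else 0 := by
  rw [colOp, lvf_X]
  simp only [Prod.mk.injEq, one_smul]
  by_cases h : s' = s ∧ j = p
  · obtain ⟨rfl, rfl⟩ := h
    simp [Finset.sum_ite_eq]
  · rw [if_neg h, Finset.sum_eq_zero]
    intro i' _
    rw [if_neg]
    rintro ⟨h1, h2, h3⟩
    exact h ⟨h1, h3⟩

/-- `opU p q = R⁰_{pq} - R²_{qp}`. -/
theorem opL0_eq (p q : Fin 3) : opL 0 p q = rowOp 0 p q - rowOp 2 q p := by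
  apply LinearMap.ext
  intro f
  simp [opL, rowOp, lvf_apply, opc, opb, opa, Fintype.sum_sum_type, sub_eq_add_neg, Finset.sum_neg_distrib]

/-- `opV p q = -C⁰_{qp} + R¹_{pq}`. -/
theorem opL1_eq (p q : Fin 3) : opL 1 p q = -colOp 0 q p + rowOp 1 p q := by
  apply LinearMap.ext
  intro f
  simp [opL, rowOp, colOp, lvf_apply, opc, opb, opa, Fintype.sum_sum_type, Finset.sum_neg_distrib]

/-- `opW p q = -C¹_{qp} + C²_{pq}`. -/
theorem opL2_eq (p q : Fin 3) : opL 2 p q = -colOp 1 q p + colOp 2 p q := by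
  apply LinearMap.ext
  intro f
  simp [opL, colOp, lvf_apply, opc, opb, opa, Fintype.sum_sum_type, Finset.sum_neg_distrib]

end RowCol


/-- **Part 6 of `stub_borelNormalForm` (registered helper stub): the Borel operators preserve every
multihomogeneous piece** (weight zero). -/
theorem stub_borelNormalForm_ops : ∀ (X p q : Fin 3) (m : MDeg) (f : Poly), f ∈ S m → opL X p q f ∈ S m :=
  fun X p q m _ hf => opL_mem_S X p q m hf

end Summit.MatrixMultiplication.MatrixMultiplication.Theorems.SymbolicSquare

end
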